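import Summits.HubbardSuperconductivity.HubbardSuperconductivity.Theorems.BalabanIRBirEveryGroundStateUniqueGround
import Summits.HubbardSuperconductivity.HubbardSuperconductivity.Theorems.BalabanIRBirEveryGroundStateSocketResidues

/-!
# Route `BalabanIR`, crux 5 `BirEveryGroundState` (`stmt-HubbardSuperconductivity-2083`):
# the line `spectral-curve-anchor` AUDITED, II — the curve-free residual and its closers

Theses-free companion of `BalabanIRBirEveryGroundStateUniqueGround.lean` (rev-5 materialisation
rule: no route file is imported, directly or transitively).

* `uniqueGroundUnderAvg_of_spectralCurveStubs` — the two OPEN stubs of the line lead's skeleton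
  `Cruxes/BirEveryGroundState/Lines/spectral_curve_anchor.lean` (`stub_groundSheetAnchored`,
  `stub_noJointEigenGround`, both taken as hypotheses VERBATIM) imply the curve-free statement
  UNIQUE GROUND STATES UNDER THE AVERAGE BOUND: at a coupling `U > 0` non-exceptional for all
  torus sides, the eventual ground-state-average bound `c L⁴ · Re tr P_{E₀} ≤ Re tr (P_{E₀} Δ_d† Δ_d)`
  forces, eventually in even `L`, `dim E₀(U, L) = 1` (by
  `finrankOne_or_forall_joint_of_anchoredOrLinear`, a ground state exists, and a joint one is
  forbidden);
* `birEveryGroundState_structural_of_uniqueGroundUnderAvg` — that statement ALONE closes the item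
  (conclusion = the item's body verbatim): selection of a non-exceptional coupling in the window
  (`exists_coupling_forall_card_roots_le_hubbardTorus`), scalar compression on a line, pigeonhole
  over an orthonormal frame, socket `birEveryGroundState_structural_of_transfer`;
* `birEveryGroundState_structural_of_spectralCurveStubs` — hence the line's own THESES-FREE closer
  from its two open stubs (the skeleton's `BirEveryGroundState_of` imports the route file through
  `…Transfer` and so cannot be the closing module);
* `birEveryGroundState_structural_of_irreducibleGroundUnderAvg` — the SYMMETRY-TOLERANT weakening
  of the residual that still closes the item: instead of `dim E₀ = 1`, irreducibility of `E₀(U, L)`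
  under the joint commutant of `H`, `N̂`, `S^z`, `Δ_d† Δ_d` (it contains translations, `D₄`, spin
  flips), conditional on the same average bound at a non-exceptional coupling; Schur
  (`exists_scalar_matrixElements_of_irreducible`) replaces "a line is scalar". Uniqueness is the
  special case `dim E₀ = 1`; a space-group ground multiplet is allowed here and forbidden there.

So the line `spectral-curve-anchor` is, for the purpose of closing `stmt-2083`, exactly the claim
"average `d`-wave order at a non-exceptional coupling forces eventually NONDEGENERATE sector ground
states" — not in print (nearest numerics: Bruus–Anglès d'Auriac, PRB 55 (1997) 9142, §5); nothing
here proves it. Kato (1966) Ch. II §1.1; Lieb, PRL 62 (1989) 1201. Folklore; no definition is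
introduced.
-/

noncomputable section

namespace Summit.HubbardSuperconductivity.HubbardSuperconductivity.Theorems

open Polynomial Matrix Finset Filter
open scoped Polynomial ComplexOrder
open Literature.Probability.LatticeModels Literature.MathematicalPhysics.QuantumLattice
open Literature.Computability.AlgebraicComplexity

namespace UniqueGround


/-- In a one-dimensional subspace every matrix has scalar matrix elements (adapted from the line
lead's skeleton `Lines/spectral_curve_anchor.lean`). [folklore] -/
theorem exists_scalar_of_finrank_one {n : Type} [Fintype n] [DecidableEq n]
    (E : Submodule ℂ (n → ℂ)) (hE : Module.finrank ℂ E = 1) (A : Matrix n n ℂ) :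
    ∃ μ : ℂ, ∀ v ∈ E, ∀ w ∈ E, star w ⬝ᵥ A *ᵥ v = μ * (star w ⬝ᵥ v) := by
  obtain ⟨e, he0, hspan⟩ := (finrank_eq_one_iff' (K := ℂ) (V := E)).mp hE
  refine ⟨(star (e : n → ℂ) ⬝ᵥ A *ᵥ (e : n → ℂ)) / (star (e : n → ℂ) ⬝ᵥ (e : n → ℂ)),
    fun v hv w hw => ?_⟩
  have he0' : star (e : n → ℂ) ⬝ᵥ (e : n → ℂ) ≠ 0 :=
    fun h0 => he0 (Subtype.ext (dotProduct_star_self_eq_zero.mp h0))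
  obtain ⟨a, ha⟩ := hspan ⟨v, hv⟩
  obtain ⟨b, hb⟩ := hspan ⟨w, hw⟩
  have hav : v = a • (e : n → ℂ) := by simpa using congrArg Subtype.val ha.symm
  have hbw : w = b • (e : n → ℂ) := by simpa using congrArg Subtype.val hb.symm
  rw [hav, hbw, star_smul, mulVec_smul, dotProduct_smul, smul_dotProduct, smul_dotProduct,
    dotProduct_smul]
  simp only [smul_eq_mul]
  field_simp

/-- Pigeonhole over an orthonormal frame (adapted from the line lead's skeleton): if the
compression of `A` to `E₀` is scalar and the average of `A` over `E₀` is at least `a` (in the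
route's `projMatrix` currency), then every unit vector of `E₀` has `a ≤ re ⟨ψ, A ψ⟩`. [folklore] -/
theorem le_re_of_scalar_of_average {n : Type} [Fintype n] [DecidableEq n]
    (E₀ : Submodule ℂ (n → ℂ)) (A : Matrix n n ℂ) (a : ℝ)
    (hscal : ∃ μ : ℂ, ∀ v ∈ E₀, ∀ w ∈ E₀, star w ⬝ᵥ A *ᵥ v = μ * (star w ⬝ᵥ v))
    (havg : a * (projMatrix (E₀.map ((WithLp.linearEquiv 2 ℂ (n → ℂ)).symm :
        (n → ℂ) →ₗ[ℂ] EuclideanSpace ℂ n))).trace.re ≤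
      (projMatrix (E₀.map ((WithLp.linearEquiv 2 ℂ (n → ℂ)).symm :
        (n → ℂ) →ₗ[ℂ] EuclideanSpace ℂ n)) * A).trace.re)
    {ψ : n → ℂ} (hψE : ψ ∈ E₀) (hunit : star ψ ⬝ᵥ ψ = 1) :
    a ≤ (star ψ ⬝ᵥ A *ᵥ ψ).re := by
  -- an orthonormal frame of `E₀`; the projection is `B Bᴴ`
  obtain ⟨k, B, hk, hBB, hcol, hfix⟩ := exists_orthonormalFrame E₀
  have hP : projMatrix (E₀.map ((WithLp.linearEquiv 2 ℂ (n → ℂ)).symm :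
      (n → ℂ) →ₗ[ℂ] EuclideanSpace ℂ n)) = B * Bᴴ :=
    proj_unique (projMatrix_isHermitian _) (Matrix.isHermitian_mul_conjTranspose_self B)
      (fun _ hw => projMatrix_map_mulVec_of_mem E₀ hw) (projMatrix_map_mulVec_mem E₀) hfix
      (frame_proj_mulVec_mem hcol)
  have hdiag : ∀ j : Fin k,
      (Bᴴ * (A * B)) j j = star (fun x => B x j) ⬝ᵥ A *ᵥ (fun x => B x j) := by
    intro j
    simp only [Matrix.mul_apply, Matrix.conjTranspose_apply, dotProduct, Matrix.mulVec,
      Pi.star_apply]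
  have hunitB : ∀ j : Fin k, star (fun x => B x j) ⬝ᵥ (fun x => B x j) = 1 := by
    intro j
    have := congrFun (congrFun hBB j) j
    simpa [Matrix.mul_apply, Matrix.conjTranspose_apply, dotProduct, Matrix.one_apply] using this
  have hkpos : 0 < k := by
    rw [hk]
    refine Submodule.one_le_finrank_iff.mpr ((Submodule.ne_bot_iff _).mpr ⟨ψ, hψE, ?_⟩)
    rintro rfl
    simp at hunit
  rw [hP, frame_proj_trace hBB, Matrix.mul_assoc, Matrix.trace_mul_comm, Matrix.mul_assoc,
    Matrix.trace] at havg
  simp only [Matrix.diag_apply, Complex.re_sum, Complex.natCast_re] at havg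
  have hsum : ∑ _j : Fin k, a ≤ ∑ j : Fin k, ((Bᴴ * (A * B)) j j).re := by
    simpa [mul_comm] using havg
  haveI : Nonempty (Fin k) := ⟨⟨0, hkpos⟩⟩
  obtain ⟨j, -, hj⟩ := Finset.exists_le_of_sum_le Finset.univ_nonempty hsum
  rw [hdiag] at hj
  obtain ⟨μ, hμ⟩ := hscal
  rw [hμ _ (hcol j) _ (hcol j), hunitB, mul_one] at hj
  rw [hμ ψ hψE ψ hψE, hunit, mul_one]
  exact hj

end UniqueGround

open UniqueGround

/-! ## The line's open debt is ground-state uniqueness under the average bound -/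

/-- **The two open stubs of line `spectral-curve-anchor` imply UNIQUE GROUND STATES UNDER THE
AVERAGE BOUND.** If `stub_groundSheetAnchored` and `stub_noJointEigenGround` hold (hypotheses
`hanch`, `hnoj`, stated verbatim; both OPEN), then at every coupling `U > 0` that is
non-exceptional for all torus sides, the eventual ground-state-average bound
`c L⁴ · Re tr P_{E₀} ≤ Re tr (P_{E₀} Δ_d† Δ_d)` forces, eventually in even `L`, a ONE-dimensional
sector ground eigenspace `E₀(U, L)` of `hubbardTorus 2 L 1 U` in `szSector N_L 0`,
`N_L = 2⌊(1-δ)L²/2⌋`: by `finrankOne_or_forall_joint_of_anchoredOrLinear` the alternative is that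
every sector ground state — and there is one, `exists_unit_isGroundStateInSector_hubbardTorus` —
is a doublon eigenvector, which `hnoj` forbids. [folklore] -/
theorem uniqueGroundUnderAvg_of_spectralCurveStubs (hanch : ∀ δ ∈ Set.Ioo (0:ℝ) (1/2), ∀ U : ℝ, 0 < U → (∀ (L : ℕ) (u' : ℝ), (hubbardTorus 2 L 1 u').charpoly.roots.toFinset.card ≤ (hubbardTorus 2 L 1 U).charpoly.roots.toFinset.card) → ∀ c : ℝ, 0 < c → (∃ L₀ : ℕ, ∀ (L : ℕ) [NeZero L], L₀ ≤ L → Even L → let N : ℕ := 2 * ⌊(1 - δ) * (L : ℝ) ^ 2 / 2⌋₊; let H := hubbardTorus 2 L 1 U; let S := szSector (Λ := FermionTorus 2 L) N 0; let E₀ := S ⊓ Module.End.eigenspace (Matrix.toLin' H) ((H.minEnergyOn S : ℝ) : ℂ); let P := projMatrix (E₀.map (Fock.toEuclidean (ι := Orb (FermionTorus 2 L)) : Fock (Orb (FermionTorus 2 L)) →ₗ[ℂ] EuclideanSpace ℂ (Finset (Orb (FermionTorus 2 L))))); c * (L : ℝ) ^ 4 * P.trace.re ≤ (P * ((pairField dWaveFormFactor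 L)ᴴ * pairField dWaveFormFactor L)).trace.re) → ∃ L₀ : ℕ, ∀ (L : ℕ) [NeZero L], L₀ ≤ L → Even L → let N : ℕ := 2 * ⌊(1 - δ) * (L : ℝ) ^ 2 / 2⌋₊; let T := hubbardTorus 2 L 1 0; let D : Matrix (Finset (Orb (FermionTorus 2 L))) (Finset (Orb (FermionTorus 2 L))) ℂ := ∑ x : FermionTorus 2 L, numberOp x 0 * numberOp x 1; let S := szSector (Λ := FermionTorus 2 L) N 0; let e₀ : ℝ := (hubbardTorus 2 L 1 U).minEnergyOn S; ∀ χ : ℂ[X][X], χ.Monic → (∀ u μ : ℂ, (χ.map (evalRingHom u)).IsRoot μ ↔ ∃ v ∈ S, v ≠ 0 ∧ (T + u • D) *ᵥ v = μ • v) → (∀ u μ : ℝ, (χ.map (evalRingHom (u : ℂ))).rootMultiplicity (μ : ℂ) = Module.finrank ℂ ↥(S ⊓ Module.End.eigenspace (Matrix.toLin' (T + (u : ℂ) • D)) (μ : ℂ))) → ∀ p : ℂ[X][X], Irreducible p → p ∣ χ → (p.map (evalRingHom (U : ℂ))).IsRoot ((e₀ : ℝ) : ℂ) → (∃ U₀ μ₀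 : ℂ, (p.map (evalRingHom U₀)).IsRoot μ₀ ∧ (χ.map (evalRingHom U₀)).rootMultiplicity μ₀ = 1) ∨ (∃ ε γ : ℂ, (X - C (C ε + C γ * X)) ∣ χ ∧ ((e₀ : ℝ) : ℂ) = ε + γ * (U : ℂ))) (hnoj : ∀ δ ∈ Set.Ioo (0:ℝ) (1/2), ∀ U : ℝ, 0 < U → (∀ (L : ℕ) (u' : ℝ), (hubbardTorus 2 L 1 u').charpoly.roots.toFinset.card ≤ (hubbardTorus 2 L 1 U).charpoly.roots.toFinset.card) → ∀ c : ℝ, 0 < c → (∃ L₀ : ℕ, ∀ (L : ℕ) [NeZero L], L₀ ≤ L → Even L → let N : ℕ := 2 * ⌊(1 - δ) * (L : ℝ) ^ 2 / 2⌋₊; let H := hubbardTorus 2 L 1 U; let S := szSector (Λ := FermionTorus 2 L) N 0; let E₀ := S ⊓ Module.End.eigenspace (Matrix.toLin' H) ((H.minEnergyOn S : ℝ) : ℂ); let P := projMatrix (E₀.map (Fock.toEuclidean (ι := Orb (FermionTorus 2 L)) : Fock (Orb (FermionTorus 2 L)) →ₗ[ℂ] EuclideanSpace ℂ (Finset (Orb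 (FermionTorus 2 L))))); c * (L : ℝ) ^ 4 * P.trace.re ≤ (P * ((pairField dWaveFormFactor L)ᴴ * pairField dWaveFormFactor L)).trace.re) → ∃ L₀ : ℕ, ∀ (L : ℕ) [NeZero L], L₀ ≤ L → Even L → let N : ℕ := 2 * ⌊(1 - δ) * (L : ℝ) ^ 2 / 2⌋₊; ∀ ψ : Fock (Orb (FermionTorus 2 L)), IsGroundStateInSector (hubbardTorus 2 L 1 U) N 0 ψ → ∀ γ : ℂ, (∑ x : FermionTorus 2 L, numberOp x 0 * numberOp x 1 : Matrix (Finset (Orb (FermionTorus 2 L))) (Finset (Orb (FermionTorus 2 L))) ℂ) *ᵥ ψ ≠ γ • ψ) : ∀ δ ∈ Set.Ioo (0:ℝ) (1/2), ∀ U : ℝ, 0 < U → (∀ (L : ℕ) (u' : ℝ), (hubbardTorus 2 L 1 u').charpoly.roots.toFinset.card ≤ (hubbardTorus 2 L 1 U).charpoly.roots.toFinset.card) → ∀ c : ℝ, 0 < c → (∃ L₀ : ℕ, ∀ (L : ℕ) [NeZero L], L₀ ≤ L → Even L → let N : ℕ := 2 * ⌊(1 - δ) * (L : ℝ) ^ 2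 / 2⌋₊; let H := hubbardTorus 2 L 1 U; let S := szSector (Λ := FermionTorus 2 L) N 0; let E₀ := S ⊓ Module.End.eigenspace (Matrix.toLin' H) ((H.minEnergyOn S : ℝ) : ℂ); let P := projMatrix (E₀.map (Fock.toEuclidean (ι := Orb (FermionTorus 2 L)) : Fock (Orb (FermionTorus 2 L)) →ₗ[ℂ] EuclideanSpace ℂ (Finset (Orb (FermionTorus 2 L))))); c * (L : ℝ) ^ 4 * P.trace.re ≤ (P * ((pairField dWaveFormFactor L)ᴴ * pairField dWaveFormFactor L)).trace.re) → ∃ L₀ : ℕ, ∀ (L : ℕ) [NeZero L], L₀ ≤ L → Even L → let N : ℕ := 2 * ⌊(1 - δ) * (L : ℝ) ^ 2 / 2⌋₊; let H := hubbardTorus 2 L 1 U; let S := szSector (Λ := FermionTorus 2 L) N 0; let E₀ := S ⊓ Module.End.eigenspace (Matrix.toLin' H) ((H.minEnergyOn S : ℝ) : ℂ); Module.finrank ℂ E₀ = 1 := by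
  intro δ hδ U hU hmax c hc havg
  obtain ⟨L₅, hL₅⟩ := hnoj δ hδ U hU hmax c hc havg
  obtain ⟨L₆, hL₆⟩ := hanch δ hδ U hU hmax c hc havg
  refine ⟨max L₅ L₆, fun L _ hL hLe => ?_⟩
  have hL5 : L₅ ≤ L := (le_max_left _ _).trans hL
  have hL6 : L₆ ≤ L := (le_max_right _ _).trans hL
  set m : ℕ := ⌊(1 - δ) * (L : ℝ) ^ 2 / 2⌋₊ with hm
  have h6 := hL₆ L hL6 hLe
  have h5 := hL₅ L hL5 hLe
  simp only at h5 h6 ⊢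
  rcases finrankOne_or_forall_joint_of_anchoredOrLinear L m U (hmax L) h6 with hfin | hjoint
  · exact hfin
  · exfalso
    -- the sector is not empty: a ground state exists, and `hnoj` forbids it to be joint
    have hδ' : (-1 : ℝ) ≤ δ := by linarith [hδ.1]
    obtain ⟨ψ, -, hgs⟩ :=
      Literature.Barriers.HubbardSuperconductivity.exists_unit_isGroundStateInSector_hubbardTorus
        U L m (Literature.Barriers.HubbardSuperconductivity.natFloor_filling_le_sq hδ' L)
    obtain ⟨γ, hγ⟩ := hjoint ψ hgs
    exact h5 ψ hgs γ hγ

/-- **CLOSER ⇐ unique ground states under the average bound** (Theses-free; conclusion = the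
item's body verbatim). Suppose that at every doping `δ ∈ (0, 1/2)` and every coupling `U > 0`
non-exceptional for all torus sides, the eventual ground-state-average bound with any constant
`c > 0` forces, eventually in even `L`, a one-dimensional sector ground eigenspace (`huniq`; NOT
proved — this is exactly the open debt of line `spectral-curve-anchor`). Then the body of
`Theses.BalabanIR.BirEveryGroundState` holds: every window contains a coupling non-exceptional
for all sides (`exists_coupling_forall_card_roots_le_hubbardTorus`); there the window hypothesis
is the average bound, `huniq` makes `E₀(U, L)` a line, the compression of `Δ_d† Δ_d` to a line is
scalar, pigeonhole over an orthonormal frame turns the average bound into the bound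
`c L⁴ ≤ Re ⟨ψ, Δ_d† Δ_d ψ⟩` for EVERY normalised sector ground state, and the socket
`birEveryGroundState_structural_of_transfer` concludes. [folklore] -/
theorem birEveryGroundState_structural_of_uniqueGroundUnderAvg
    (huniq : ∀ δ ∈ Set.Ioo (0:ℝ) (1/2), ∀ U : ℝ, 0 < U →
      (∀ (L : ℕ) (u' : ℝ), (hubbardTorus 2 L 1 u').charpoly.roots.toFinset.card ≤
        (hubbardTorus 2 L 1 U).charpoly.roots.toFinset.card) →
      ∀ c : ℝ, 0 < c →
      (∃ L₀ : ℕ, ∀ (L : ℕ) [NeZero L], L₀ ≤ L → Even L →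
        let N : ℕ := 2 * ⌊(1 - δ) * (L : ℝ) ^ 2 / 2⌋₊
        let H := hubbardTorus 2 L 1 U
        let S := szSector (Λ := FermionTorus 2 L) N 0
        let E₀ := S ⊓ Module.End.eigenspace (Matrix.toLin' H) ((H.minEnergyOn S : ℝ) : ℂ)
        let P := projMatrix (E₀.map (Fock.toEuclidean (ι := Orb (FermionTorus 2 L)) :
          Fock (Orb (FermionTorus 2 L)) →ₗ[ℂ] EuclideanSpace ℂ (Finset (Orb (FermionTorus 2 L)))))
        c * (L : ℝ) ^ 4 * P.trace.re ≤
          (P * ((pairField dWaveFormFactor L)ᴴ * pairField dWaveFormFactor L)).trace.re) →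
      ∃ L₀ : ℕ, ∀ (L : ℕ) [NeZero L], L₀ ≤ L → Even L →
        let N : ℕ := 2 * ⌊(1 - δ) * (L : ℝ) ^ 2 / 2⌋₊
        let H := hubbardTorus 2 L 1 U
        let S := szSector (Λ := FermionTorus 2 L) N 0
        let E₀ := S ⊓ Module.End.eigenspace (Matrix.toLin' H) ((H.minEnergyOn S : ℝ) : ℂ)
        Module.finrank ℂ E₀ = 1) :
    ∀ (δ U₁ U₂ c : ℝ), δ ∈ Set.Ioo (0:ℝ) (1/2) → 0 < U₁ → U₁ < U₂ → 0 < c → (∀ U ∈ Set.Ioo U₁ U₂, ∃ L₀ : ℕ, ∀ (L : ℕ) [NeZero L], L₀ ≤ L → Even L → let N : ℕ := 2 * ⌊(1 - δ) * (L : ℝ) ^ 2 / 2⌋₊; let H := Literature.MathematicalPhysics.QuantumLattice.hubbardTorus 2 L 1 U; let S := Literature.MathematicalPhysics.QuantumLattice.szSector (Λ := Literature.MathematicalPhysics.QuantumLattice.FermionTorus 2 L) N 0; let E₀ := S ⊓ Module.End.eigenspace (Matrix.toLin' H) ((H.minEnergyOn S : ℝ) : ℂ); let P := Literature.MathematicalPhysics.QuantumLattice.projMatrix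 (E₀.map (Literature.MathematicalPhysics.QuantumLattice.Fock.toEuclidean (ι := Literature.MathematicalPhysics.QuantumLattice.Orb (Literature.MathematicalPhysics.QuantumLattice.FermionTorus 2 L)) : Literature.MathematicalPhysics.QuantumLattice.Fock (Literature.MathematicalPhysics.QuantumLattice.Orb (Literature.MathematicalPhysics.QuantumLattice.FermionTorus 2 L)) →ₗ[ℂ] EuclideanSpace ℂ (Finset (Literature.MathematicalPhysics.QuantumLattice.Orb (Literature.MathematicalPhysics.QuantumLattice.FermionTorus 2 L))))); c * (L : ℝ) ^ 4 * P.trace.re ≤ (P * (Matrix.conjTranspose (Literature.MathematicalPhysics.QuantumLattice.pairField Literature.MathematicalPhysics.QuantumLattice.dWaveFormFactor L) * Literature.MathematicalPhysics.QuantumLattice.pairField Literature.MathematicalPhysics.QuantumLattice.dWaveFormFactor L)).trace.re) → ∃ U ∈ Set.Ioo U₁ U₂, ∀ (N : ℕ → ℕ) (ψ : ∀ L, Literature.MathematicalPhysics.QuantumLattice.Fock (Literature.MathematicalPhysics.QuantumLattice.Orb (Literature.MathematicalPhysics.QuantumLattice.FermionTorus 2 L))), (∀ L, Even L → N L = 2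 * ⌊(1 - δ) * (L : ℝ) ^ 2 / 2⌋₊ ∧ star (ψ L) ⬝ᵥ ψ L = 1 ∧ Literature.MathematicalPhysics.QuantumLattice.IsGroundStateInSector (Literature.MathematicalPhysics.QuantumLattice.hubbardTorus 2 L 1 U) (N L) 0 (ψ L)) → Literature.Probability.LatticeModels.HasLongRangeOrder (fun k => Literature.Probability.LatticeModels.halfOpenBox 2 (2 * k)) (fun k => Literature.MathematicalPhysics.QuantumLattice.torusPullback (Literature.MathematicalPhysics.QuantumLattice.pairFieldCorr Literature.MathematicalPhysics.QuantumLattice.dWaveFormFactor ψ) (2 * k)) := by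
  refine birEveryGroundState_structural_of_transfer fun δ U₁ U₂ c hδ hU₁ hU₁₂ hc hyp => ?_
  -- a coupling of the window non-exceptional for all torus sides
  obtain ⟨U, hU, hmax⟩ := exists_coupling_forall_card_roots_le_hubbardTorus hU₁₂
  have hUpos : 0 < U := hU₁.trans hU.1
  have havg := hyp U hU
  obtain ⟨L₁, hL₁⟩ := huniq δ hδ U hUpos hmax c hc havg
  obtain ⟨L₂, hL₂⟩ := havg
  refine ⟨U, hU, c, hc, max L₁ L₂, fun L _ hL hLe ψ hgs hunit => ?_⟩
  have hL1 : L₁ ≤ L := (le_max_left _ _).trans hL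
  have hL2 : L₂ ≤ L := (le_max_right _ _).trans hL
  -- the objects of side `L`
  set A : Matrix (Finset (Orb (FermionTorus 2 L))) (Finset (Orb (FermionTorus 2 L))) ℂ :=
    (pairField dWaveFormFactor L)ᴴ * pairField dWaveFormFactor L with hA
  set H : Matrix (Finset (Orb (FermionTorus 2 L))) (Finset (Orb (FermionTorus 2 L))) ℂ :=
    hubbardTorus 2 L 1 U with hH
  set S : Submodule ℂ (Fock (Orb (FermionTorus 2 L))) :=
    szSector (Λ := FermionTorus 2 L) (2 * ⌊(1 - δ) * (L : ℝ) ^ 2 / 2⌋₊) 0 with hS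
  set E₀ : Submodule ℂ (Fock (Orb (FermionTorus 2 L))) :=
    S ⊓ Module.End.eigenspace (Matrix.toLin' H) ((H.minEnergyOn S : ℝ) : ℂ) with hE₀
  -- uniqueness at side `L`
  have hfin : Module.finrank ℂ E₀ = 1 := by
    have := hL₁ L hL1 hLe
    simpa only using this
  -- the ground state `ψ`
  obtain ⟨hψS, -, hHψ⟩ := hgs
  have hψE : ψ ∈ E₀ := by
    refine Submodule.mem_inf.mpr ⟨hψS, ?_⟩
    rw [Module.End.mem_eigenspace_iff, Matrix.toLin'_apply]
    exact hHψ
  -- the window average at side `L`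
  have havgL := hL₂ L hL2 hLe
  simp only at havgL
  have hmap : E₀.map (Fock.toEuclidean (ι := Orb (FermionTorus 2 L)) :
      Fock (Orb (FermionTorus 2 L)) →ₗ[ℂ] EuclideanSpace ℂ (Finset (Orb (FermionTorus 2 L)))) =
      E₀.map ((WithLp.linearEquiv 2 ℂ (Finset (Orb (FermionTorus 2 L)) → ℂ)).symm :
        (Finset (Orb (FermionTorus 2 L)) → ℂ) →ₗ[ℂ]
          EuclideanSpace ℂ (Finset (Orb (FermionTorus 2 L)))) := rfl
  rw [hmap] at havgL
  exact le_re_of_scalar_of_average E₀ A _ (exists_scalar_of_finrank_one E₀ hfin A) havgL hψE hunit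

/-- **THE LINE'S THESES-FREE CLOSER: `stub_groundSheetAnchored` + `stub_noJointEigenGround` ⇒
the body of the item.** Composition of `uniqueGroundUnderAvg_of_spectralCurveStubs` with
`birEveryGroundState_structural_of_uniqueGroundUnderAvg`; once the two open stubs of line
`spectral-curve-anchor` are theorems, `fun … => birEveryGroundState_structural_of_spectralCurveStubs
stub_groundSheetAnchored stub_noJointEigenGround …` closes `stmt-HubbardSuperconductivity-2083`
from a module importing no route file. [folklore] -/
theorem birEveryGroundState_structural_of_spectralCurveStubs
    (hanch : ∀ δ ∈ Set.Ioo (0:ℝ) (1/2), ∀ U : ℝ, 0 < U →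
      (∀ (L : ℕ) (u' : ℝ), (hubbardTorus 2 L 1 u').charpoly.roots.toFinset.card ≤
        (hubbardTorus 2 L 1 U).charpoly.roots.toFinset.card) →
      ∀ c : ℝ, 0 < c →
      (∃ L₀ : ℕ, ∀ (L : ℕ) [NeZero L], L₀ ≤ L → Even L →
        let N : ℕ := 2 * ⌊(1 - δ) * (L : ℝ) ^ 2 / 2⌋₊
        let H := hubbardTorus 2 L 1 U
        let S := szSector (Λ := FermionTorus 2 L) N 0
        let E₀ := S ⊓ Module.End.eigenspace (Matrix.toLin' H) ((H.minEnergyOn S : ℝ) : ℂ)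
        let P := projMatrix (E₀.map (Fock.toEuclidean (ι := Orb (FermionTorus 2 L)) :
          Fock (Orb (FermionTorus 2 L)) →ₗ[ℂ] EuclideanSpace ℂ (Finset (Orb (FermionTorus 2 L)))))
        c * (L : ℝ) ^ 4 * P.trace.re ≤
          (P * ((pairField dWaveFormFactor L)ᴴ * pairField dWaveFormFactor L)).trace.re) →
      ∃ L₀ : ℕ, ∀ (L : ℕ) [NeZero L], L₀ ≤ L → Even L →
        let N : ℕ := 2 * ⌊(1 - δ) * (L : ℝ) ^ 2 / 2⌋₊
        let T := hubbardTorus 2 L 1 0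
        let D : Matrix (Finset (Orb (FermionTorus 2 L))) (Finset (Orb (FermionTorus 2 L))) ℂ :=
          ∑ x : FermionTorus 2 L, numberOp x 0 * numberOp x 1
        let S := szSector (Λ := FermionTorus 2 L) N 0
        let e₀ : ℝ := (hubbardTorus 2 L 1 U).minEnergyOn S
        ∀ χ : ℂ[X][X], χ.Monic →
          (∀ u μ : ℂ, (χ.map (evalRingHom u)).IsRoot μ ↔ ∃ v ∈ S, v ≠ 0 ∧ (T + u • D) *ᵥ v = μ • v) →
          (∀ u μ : ℝ, (χ.map (evalRingHom (u : ℂ))).rootMultiplicity (μ : ℂ) =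
            Module.finrank ℂ ↥(S ⊓ Module.End.eigenspace (Matrix.toLin' (T + (u : ℂ) • D)) (μ : ℂ))) →
          ∀ p : ℂ[X][X], Irreducible p → p ∣ χ → (p.map (evalRingHom (U : ℂ))).IsRoot ((e₀ : ℝ) : ℂ) →
            (∃ U₀ μ₀ : ℂ, (p.map (evalRingHom U₀)).IsRoot μ₀ ∧
              (χ.map (evalRingHom U₀)).rootMultiplicity μ₀ = 1) ∨
            (∃ ε γ : ℂ, (X - C (C ε + C γ * X)) ∣ χ ∧ ((e₀ : ℝ) : ℂ) = ε + γ * (U : ℂ)))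
    (hnoj : ∀ δ ∈ Set.Ioo (0:ℝ) (1/2), ∀ U : ℝ, 0 < U →
      (∀ (L : ℕ) (u' : ℝ), (hubbardTorus 2 L 1 u').charpoly.roots.toFinset.card ≤
        (hubbardTorus 2 L 1 U).charpoly.roots.toFinset.card) →
      ∀ c : ℝ, 0 < c →
      (∃ L₀ : ℕ, ∀ (L : ℕ) [NeZero L], L₀ ≤ L → Even L →
        let N : ℕ := 2 * ⌊(1 - δ) * (L : ℝ) ^ 2 / 2⌋₊
        let H := hubbardTorus 2 L 1 U
        let S := szSector (Λ := FermionTorus 2 L) N 0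
        let E₀ := S ⊓ Module.End.eigenspace (Matrix.toLin' H) ((H.minEnergyOn S : ℝ) : ℂ)
        let P := projMatrix (E₀.map (Fock.toEuclidean (ι := Orb (FermionTorus 2 L)) :
          Fock (Orb (FermionTorus 2 L)) →ₗ[ℂ] EuclideanSpace ℂ (Finset (Orb (FermionTorus 2 L)))))
        c * (L : ℝ) ^ 4 * P.trace.re ≤
          (P * ((pairField dWaveFormFactor L)ᴴ * pairField dWaveFormFactor L)).trace.re) →
      ∃ L₀ : ℕ, ∀ (L : ℕ) [NeZero L], L₀ ≤ L → Even L →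
        let N : ℕ := 2 * ⌊(1 - δ) * (L : ℝ) ^ 2 / 2⌋₊
        ∀ ψ : Fock (Orb (FermionTorus 2 L)), IsGroundStateInSector (hubbardTorus 2 L 1 U) N 0 ψ →
          ∀ γ : ℂ, (∑ x : FermionTorus 2 L, numberOp x 0 * numberOp x 1 :
            Matrix (Finset (Orb (FermionTorus 2 L))) (Finset (Orb (FermionTorus 2 L))) ℂ) *ᵥ ψ ≠
              γ • ψ) :
    ∀ (δ U₁ U₂ c : ℝ), δ ∈ Set.Ioo (0:ℝ) (1/2) → 0 < U₁ → U₁ < U₂ → 0 < c → (∀ U ∈ Set.Ioo U₁ U₂, ∃ L₀ : ℕ, ∀ (L : ℕ) [NeZero L], L₀ ≤ L → Even L → let N : ℕ := 2 * ⌊(1 - δ) * (L : ℝ) ^ 2 / 2⌋₊; let H := Literature.MathematicalPhysics.QuantumLattice.hubbardTorus 2 L 1 U; let S := Literature.MathematicalPhysics.QuantumLattice.szSector (Λ := Literature.MathematicalPhysics.QuantumLattice.FermionTorus 2 L) N 0; let E₀ := S ⊓ Module.End.eigenspace (Matrix.toLin' H) ((H.minEnergyOn S : ℝ) : ℂ);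 let P := Literature.MathematicalPhysics.QuantumLattice.projMatrix (E₀.map (Literature.MathematicalPhysics.QuantumLattice.Fock.toEuclidean (ι := Literature.MathematicalPhysics.QuantumLattice.Orb (Literature.MathematicalPhysics.QuantumLattice.FermionTorus 2 L)) : Literature.MathematicalPhysics.QuantumLattice.Fock (Literature.MathematicalPhysics.QuantumLattice.Orb (Literature.MathematicalPhysics.QuantumLattice.FermionTorus 2 L)) →ₗ[ℂ] EuclideanSpace ℂ (Finset (Literature.MathematicalPhysics.QuantumLattice.Orb (Literature.MathematicalPhysics.QuantumLattice.FermionTorus 2 L))))); c * (L : ℝ) ^ 4 * P.trace.re ≤ (P * (Matrix.conjTranspose (Literature.MathematicalPhysics.QuantumLattice.pairField Literature.MathematicalPhysics.QuantumLattice.dWaveFormFactor L) * Literature.MathematicalPhysics.QuantumLattice.pairField Literature.MathematicalPhysics.QuantumLattice.dWaveFormFactor L)).trace.re) → ∃ U ∈ Set.Ioo U₁ U₂, ∀ (N : ℕ → ℕ) (ψ : ∀ L, Literature.MathematicalPhysics.QuantumLattice.Fock (Literature.MathematicalPhysics.QuantumLattice.Orb (Literature.MathematicalPhysics.QuantumLattice.FermionTorus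 2 L))), (∀ L, Even L → N L = 2 * ⌊(1 - δ) * (L : ℝ) ^ 2 / 2⌋₊ ∧ star (ψ L) ⬝ᵥ ψ L = 1 ∧ Literature.MathematicalPhysics.QuantumLattice.IsGroundStateInSector (Literature.MathematicalPhysics.QuantumLattice.hubbardTorus 2 L 1 U) (N L) 0 (ψ L)) → Literature.Probability.LatticeModels.HasLongRangeOrder (fun k => Literature.Probability.LatticeModels.halfOpenBox 2 (2 * k)) (fun k => Literature.MathematicalPhysics.QuantumLattice.torusPullback (Literature.MathematicalPhysics.QuantumLattice.pairFieldCorr Literature.MathematicalPhysics.QuantumLattice.dWaveFormFactor ψ) (2 * k)) :=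
  birEveryGroundState_structural_of_uniqueGroundUnderAvg
    (uniqueGroundUnderAvg_of_spectralCurveStubs hanch hnoj)

/-- **CLOSER ⇐ irreducible ground multiplets under the average bound** (Theses-free; the
symmetry-tolerant weakening of `birEveryGroundState_structural_of_uniqueGroundUnderAvg`, and the
conditional form of `birEveryGroundState_structural_of_irreducibleGround`). Suppose that at every
doping `δ ∈ (0, 1/2)` and every coupling `U > 0` non-exceptional for all torus sides, the eventual
ground-state-average bound with any constant `c > 0` forces, eventually in even `L`, that the
sector ground eigenspace `E₀(U, L)` of `H = hubbardTorus 2 L 1 U` has no subspace other than `⊥`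
and itself invariant under every matrix commuting with `H`, `N̂`, `S^z` and `Y = Δ_d† Δ_d`
(`hirr`; NOT proved). Then the body of `Theses.BalabanIR.BirEveryGroundState` holds: at a
non-exceptional coupling of the window (`exists_coupling_forall_card_roots_le_hubbardTorus`) the
commutant preserves `E₀` and is `ᴴ`-closed, so by Schur
(`exists_scalar_matrixElements_of_irreducible`) the compression of `Y` to `E₀(U, L)` is scalar,
pigeonhole (`UniqueGround.le_re_of_scalar_of_average`) turns the average bound into the bound for
every normalised sector ground state, and `birEveryGroundState_structural_of_transfer` concludes.
Serre, *Linear Representations of Finite Groups*, §2.2; Kato (1966) II §6.1. [folklore] -/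
theorem birEveryGroundState_structural_of_irreducibleGroundUnderAvg
    (hirr : ∀ δ ∈ Set.Ioo (0:ℝ) (1/2), ∀ U : ℝ, 0 < U →
      (∀ (L : ℕ) (u' : ℝ), (hubbardTorus 2 L 1 u').charpoly.roots.toFinset.card ≤
        (hubbardTorus 2 L 1 U).charpoly.roots.toFinset.card) →
      ∀ c : ℝ, 0 < c →
      (∃ L₀ : ℕ, ∀ (L : ℕ) [NeZero L], L₀ ≤ L → Even L →
        let N : ℕ := 2 * ⌊(1 - δ) * (L : ℝ) ^ 2 / 2⌋₊
        let H := hubbardTorus 2 L 1 U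
        let S := szSector (Λ := FermionTorus 2 L) N 0
        let E₀ := S ⊓ Module.End.eigenspace (Matrix.toLin' H) ((H.minEnergyOn S : ℝ) : ℂ)
        let P := projMatrix (E₀.map (Fock.toEuclidean (ι := Orb (FermionTorus 2 L)) :
          Fock (Orb (FermionTorus 2 L)) →ₗ[ℂ] EuclideanSpace ℂ (Finset (Orb (FermionTorus 2 L)))))
        c * (L : ℝ) ^ 4 * P.trace.re ≤
          (P * ((pairField dWaveFormFactor L)ᴴ * pairField dWaveFormFactor L)).trace.re) →
      ∃ L₀ : ℕ, ∀ (L : ℕ) [NeZero L], L₀ ≤ L → Even L →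
        let N : ℕ := 2 * ⌊(1 - δ) * (L : ℝ) ^ 2 / 2⌋₊
        let H := hubbardTorus 2 L 1 U
        let S := szSector (Λ := FermionTorus 2 L) N 0
        let E₀ := S ⊓ Module.End.eigenspace (Matrix.toLin' H) ((H.minEnergyOn S : ℝ) : ℂ)
        let Y : Matrix (Finset (Orb (FermionTorus 2 L))) (Finset (Orb (FermionTorus 2 L))) ℂ :=
          (pairField dWaveFormFactor L)ᴴ * pairField dWaveFormFactor L
        ∀ K' : Submodule ℂ (Fock (Orb (FermionTorus 2 L))), K' ≤ E₀ →
          (∀ X : Matrix (Finset (Orb (FermionTorus 2 L))) (Finset (Orb (FermionTorus 2 L))) ℂ,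
            X * H = H * X → X * totalNumber = totalNumber * X →
            X * HubbardWave0.spinZ = HubbardWave0.spinZ * X → X * Y = Y * X →
            ∀ v ∈ K', X *ᵥ v ∈ K') →
          K' = ⊥ ∨ K' = E₀) :
    ∀ (δ U₁ U₂ c : ℝ), δ ∈ Set.Ioo (0:ℝ) (1/2) → 0 < U₁ → U₁ < U₂ → 0 < c → (∀ U ∈ Set.Ioo U₁ U₂, ∃ L₀ : ℕ, ∀ (L : ℕ) [NeZero L], L₀ ≤ L → Even L → let N : ℕ := 2 * ⌊(1 - δ) * (L : ℝ) ^ 2 / 2⌋₊; let H := Literature.MathematicalPhysics.QuantumLattice.hubbardTorus 2 L 1 U; let S := Literature.MathematicalPhysics.QuantumLattice.szSector (Λ := Literature.MathematicalPhysics.QuantumLattice.FermionTorus 2 L) N 0; let E₀ := S ⊓ Module.End.eigenspace (Matrix.toLin' H) ((H.minEnergyOn S : ℝ) : ℂ); let P := Literature.MathematicalPhysics.QuantumLattice.projMatrix (E₀.map (Literature.MathematicalPhysics.QuantumLattice.Fock.toEuclidean (ι := Literature.MathematicalPhysics.QuantumLattice.Orb (Literature.MathematicalPhysics.QuantumLattice.FermionTorus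 2 L)) : Literature.MathematicalPhysics.QuantumLattice.Fock (Literature.MathematicalPhysics.QuantumLattice.Orb (Literature.MathematicalPhysics.QuantumLattice.FermionTorus 2 L)) →ₗ[ℂ] EuclideanSpace ℂ (Finset (Literature.MathematicalPhysics.QuantumLattice.Orb (Literature.MathematicalPhysics.QuantumLattice.FermionTorus 2 L))))); c * (L : ℝ) ^ 4 * P.trace.re ≤ (P * (Matrix.conjTranspose (Literature.MathematicalPhysics.QuantumLattice.pairField Literature.MathematicalPhysics.QuantumLattice.dWaveFormFactor L) * Literature.MathematicalPhysics.QuantumLattice.pairField Literature.MathematicalPhysics.QuantumLattice.dWaveFormFactor L)).trace.re) → ∃ U ∈ Set.Ioo U₁ U₂, ∀ (N : ℕ → ℕ) (ψ : ∀ L, Literature.MathematicalPhysics.QuantumLattice.Fock (Literature.MathematicalPhysics.QuantumLattice.Orb (Literature.MathematicalPhysics.QuantumLattice.FermionTorus 2 L))), (∀ L, Even L → N L = 2 * ⌊(1 - δ) * (L : ℝ) ^ 2 / 2⌋₊ ∧ star (ψ L) ⬝ᵥ ψ L = 1 ∧ Literature.MathematicalPhysics.QuantumLattice.IsGroundStateInSector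 (Literature.MathematicalPhysics.QuantumLattice.hubbardTorus 2 L 1 U) (N L) 0 (ψ L)) → Literature.Probability.LatticeModels.HasLongRangeOrder (fun k => Literature.Probability.LatticeModels.halfOpenBox 2 (2 * k)) (fun k => Literature.MathematicalPhysics.QuantumLattice.torusPullback (Literature.MathematicalPhysics.QuantumLattice.pairFieldCorr Literature.MathematicalPhysics.QuantumLattice.dWaveFormFactor ψ) (2 * k)) := by
  refine birEveryGroundState_structural_of_transfer fun δ U₁ U₂ c hδ hU₁ hU₁₂ hc hyp => ?_
  -- a coupling of the window non-exceptional for all torus sides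
  obtain ⟨U, hU, hmax⟩ := exists_coupling_forall_card_roots_le_hubbardTorus hU₁₂
  have hUpos : 0 < U := hU₁.trans hU.1
  have havg := hyp U hU
  obtain ⟨L₁, hL₁⟩ := hirr δ hδ U hUpos hmax c hc havg
  obtain ⟨L₂, hL₂⟩ := havg
  refine ⟨U, hU, c, hc, max L₁ L₂, fun L _ hL hLe ψ hgs hunit => ?_⟩
  have hL1 : L₁ ≤ L := (le_max_left _ _).trans hL
  have hL2 : L₂ ≤ L := (le_max_right _ _).trans hL
  -- the objects of side `L`
  set Y : Matrix (Finset (Orb (FermionTorus 2 L))) (Finset (Orb (FermionTorus 2 L))) ℂ :=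
    (pairField dWaveFormFactor L)ᴴ * pairField dWaveFormFactor L with hY
  set H : Matrix (Finset (Orb (FermionTorus 2 L))) (Finset (Orb (FermionTorus 2 L))) ℂ :=
    hubbardTorus 2 L 1 U with hH
  set Sec : Submodule ℂ (Fock (Orb (FermionTorus 2 L))) :=
    szSector (Λ := FermionTorus 2 L) (2 * ⌊(1 - δ) * (L : ℝ) ^ 2 / 2⌋₊) 0 with hSec
  set E₀ : Submodule ℂ (Fock (Orb (FermionTorus 2 L))) :=
    Sec ⊓ Module.End.eigenspace (Matrix.toLin' H) ((H.minEnergyOn Sec : ℝ) : ℂ) with hE₀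
  -- irreducibility at side `L`
  have hirrL := hL₁ L hL1 hLe
  simp only at hirrL
  -- a matrix commuting with `H`, `N̂`, `S^z` maps the sector ground eigenspace into itself
  have hpres : ∀ X : Matrix (Finset (Orb (FermionTorus 2 L))) (Finset (Orb (FermionTorus 2 L))) ℂ,
      X * H = H * X → X * totalNumber = totalNumber * X →
      X * HubbardWave0.spinZ = HubbardWave0.spinZ * X → ∀ v ∈ E₀, X *ᵥ v ∈ E₀ := by
    intro X h1 h2 h3 v hv
    obtain ⟨hvS, hvE⟩ := Submodule.mem_inf.mp hv
    rw [mem_szSector_iff, LiebTwo.isNParticle_iff_totalNumber] at hvS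
    rw [Module.End.mem_eigenspace_iff, Matrix.toLin'_apply] at hvE
    refine Submodule.mem_inf.mpr ⟨?_, ?_⟩
    · rw [mem_szSector_iff, LiebTwo.isNParticle_iff_totalNumber]
      refine ⟨?_, ?_⟩
      · rw [mulVec_mulVec, ← h2, ← mulVec_mulVec, hvS.1, mulVec_smul]
      · rw [mulVec_mulVec, ← h3, ← mulVec_mulVec, hvS.2, mulVec_smul]
    · rw [Module.End.mem_eigenspace_iff, Matrix.toLin'_apply, mulVec_mulVec, ← h1, ← mulVec_mulVec,
        hvE, mulVec_smul]
  -- the joint commutant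
  let Sym : Set (Matrix (Finset (Orb (FermionTorus 2 L))) (Finset (Orb (FermionTorus 2 L))) ℂ) :=
    {X | X * H = H * X ∧ X * totalNumber = totalNumber * X ∧
      X * HubbardWave0.spinZ = HubbardWave0.spinZ * X ∧ X * Y = Y * X}
  have hSA : ∀ X ∈ Sym, X * Y = Y * X := fun X hX => hX.2.2.2
  have hSK : ∀ X ∈ Sym, ∀ v ∈ E₀, X *ᵥ v ∈ E₀ := fun X hX v hv =>
    hpres X hX.1 hX.2.1 hX.2.2.1 v hv
  -- the commutant is `ᴴ`-closed (`H`, `N̂`, `S^z`, `Y` are Hermitian)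
  have hSK' : ∀ X ∈ Sym, ∀ v ∈ E₀, Xᴴ *ᵥ v ∈ E₀ := fun X hX v hv =>
    hpres Xᴴ (conjTranspose_commute_of_commute (LiebThm1.hamiltonian_isHermitian _ 1 U) hX.1)
      (conjTranspose_commute_of_commute totalNumber_isHermitian hX.2.1)
      (conjTranspose_commute_of_commute HubbardWave0.spinZ_isHermitian hX.2.2.1) v hv
  have hirr' : ∀ K' : Submodule ℂ (Fock (Orb (FermionTorus 2 L))), K' ≤ E₀ →
      (∀ X ∈ Sym, ∀ v ∈ K', X *ᵥ v ∈ K') → K' = ⊥ ∨ K' = E₀ := fun K' hK' hinv =>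
    hirrL K' hK' fun X h1 h2 h3 h4 v hv => hinv X ⟨h1, h2, h3, h4⟩ v hv
  have hscal : ∃ μ : ℂ, ∀ v ∈ E₀, ∀ w ∈ E₀, star w ⬝ᵥ Y *ᵥ v = μ * (star w ⬝ᵥ v) :=
    exists_scalar_matrixElements_of_irreducible E₀ Y Sym hSA hSK hSK' hirr'
  -- the ground state `ψ`
  obtain ⟨hψS, -, hHψ⟩ := hgs
  have hψE : ψ ∈ E₀ := by
    refine Submodule.mem_inf.mpr ⟨hψS, ?_⟩
    rw [Module.End.mem_eigenspace_iff, Matrix.toLin'_apply]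
    exact hHψ
  -- the window average at side `L`
  have havgL := hL₂ L hL2 hLe
  simp only at havgL
  have hmap : E₀.map (Fock.toEuclidean (ι := Orb (FermionTorus 2 L)) :
      Fock (Orb (FermionTorus 2 L)) →ₗ[ℂ] EuclideanSpace ℂ (Finset (Orb (FermionTorus 2 L)))) =
      E₀.map ((WithLp.linearEquiv 2 ℂ (Finset (Orb (FermionTorus 2 L)) → ℂ)).symm :
        (Finset (Orb (FermionTorus 2 L)) → ℂ) →ₗ[ℂ]
          EuclideanSpace ℂ (Finset (Orb (FermionTorus 2 L)))) := rfl
  rw [hmap] at havgL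
  exact le_re_of_scalar_of_average E₀ Y _ hscal havgL hψE hunit

end Summit.HubbardSuperconductivity.HubbardSuperconductivity.Theorems
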